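import Summits.QuantumFields.BalabanUV.Beta.FP.TowerK2bStoreyBridgeTwo
import Summits.QuantumFields.BalabanUV.Beta.FP.TorusCompositeObjects
import Summits.QuantumFields.BalabanUV.Beta.CompositeOneShotJetData

/-!
# `BalabanUV.Beta.FP.TowerK2bDefectClosed` — road «FP», binder row D1, ROUTE T (β1): **THE WARD DEFECT OF THE END WRAPPER IN CLOSED FORM AT EVERY COMPOSITE DEPTH**
# (`g48/SPEC-61.md` §4 (iii); [D1P3-G48-HANDOFF-FINAL] item (3)): for every `m`, any box `M = Lc^(m+2)·M′`, an2's even composite mixed family `ℳ̂₂ᵉ⁽ᵐ⁺²⁾(·; ρ′, w)` (PART 31d ∕ 33c's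
# `hV` verbatim) and any torus gauge function `λ`:
# `Σ_b (Dλ)_b • ℳ̂₂ᵉ⁽ᵐ⁺²⁾(b; ρ′,w)|ff = (−wM2) • (E_λ·Ĉ⁽ᵐ⁺²⁾_{ρ′,w} − Ĉ⁽ᵐ⁺²⁾_{ρ′,w}·E_λ) + Σ_s λ s • R m ρ′ w s`,
# the site-remainder family `R` DISPLAYED BY ITS TWO RECURSION PINS — `hR0`: `R 0 ρ′ w s` = `TowerK2bStoreyBridgeTwo.def_depthTwo`'s transport-variation word (depth 2);
# `hRsucc`: `R (m+1) ρ′ w s` = `def_succ`'s top D-words at depth `m+3` (roots `R_{m+2}`, legs `compLinKer (m+2)`) `+ Σ_{κ,e ∈ win(ρ′,w)} ℓ(ρ′,w; κ,e) • R m κ (Lc•w+e) s`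
# (the depth-`(m+2)` remainders at the WINDOW BONDS, weighted by the top linear brick) — i.e. v8∕v9's `Def(λ; ρ′,w)` at EVERY box `n = m` of the END wrapper, ∃-free

WHY (`g48/SPEC-61.md` §4 (iii); journal [D1P3-G49-ONLINE]).  `TowerK2bStoreyBridgeTwo` gives the depth-2 closed form (`def_depthTwo`) and the successor step with the LOWER rows as
hypotheses (`def_succ`, any remainders `Rl`); this file runs the induction the two were built for: on the depth, over ONE finest torus `M`, with the coarse period GENERALISED
(`M = Lc^(m+3)·M′ = Lc^(m+2)·(Lc·M′)`: the lower families of `def_succ` are the depth-`(m+2)` families rooted at the window bonds `(κ, Lc•w+e)` with coarse period `Lc·M′` —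
exactly the induction hypothesis one composite down; `NeZero (Lc·M′ μ)` by instance).  The remainder never depends on `M′` (only `wrapPt M`, `translate M`, `pbox M` enter), so `R`
carries `(m, ρ′, w, s)` only.  USE: Engine C's depth-3 (K2L at `n = 1`) objects are `R 1` unrolled once (`hRsucc 0` over `hR0`); whoever types the storeywise door's H-side right side
(an2 successor item (3), on the law owner's letter) contracts THIS `R m` against `Ŝ` — (J-R₂″)'s left side at box `n = m` is `Σ_β (Ŝ_{a′}(β) • Σ_s λ_a s • R m β s + (a ↔ a′))`
with `TowerK2bDefectSplit.defect_eq_commutator_add_root` splitting each storey's word.  [folklore] induction BY NAME over the bridge's two theorems; no `def`, no `def … : Prop`,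
nothing cited, 0 sorry.  (J-R₂″) NOT claimed either way (by value NOT inhabited at n = 0 at the road's read-outs — Engine C K2L-C ∕ K2L-SPLIT, zero weight; Q-FP-47-1 law-level,
an2 A-4 l.68310); nothing typed on the order-2 H-side (ROAD POLICY g49).  Nothing of Bałaban's asserted, valued or discharged; 0 estimates; 0∕4 row-D1 binders (hW, hR, D1Tel,
D1Rep); ROOT M‴ p325680 ∕ P5c ∕ D6 untouched; NOT (C1), NOT (T-ID), NOT D1, NEVER «G-an2-4 closed», NOT BetaPertH, NOT continuum, NOT Clay.

HONEST DEPENDENCY (page 1, mandatory): continuum YM on T⁴ ⇐ BetaPertH ∧ nine spine estimates (0/9 proved); BetaPertH ⇐ (D1) ∧ (D4) ∧ CAP+tail;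
G-an2-4 gates asym, D1 and NE2/3/4.  HONEST FRAMING (cell contract, verbatim): «discharging `BetaPertH` makes Bałaban's UV stability UNCONDITIONAL —
a real constructive-QFT result; it is NOT the continuum limit and NOT the Clay problem.»  ABSOLUTE RULE (cell charter, verbatim): «No internally-minted
statement may enter as a cited fact. Every hypothesis is either kernel-proved in this package or a verbatim quotation of a PUBLISHED theorem with page
reference. The manuscript(s) under audit are NOT citable for their own disputed steps — they are the thing under adjudication; programme-internal
(2001/route/tribunal) claims are never citable.»  Road «FP» OWNER, b2b-balaban-beta-d1-p3 gen 49, 2026-08-28.  No existing file touched.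
-/

noncomputable section

open scoped BigOperators

namespace Summit.QuantumFields.BalabanUV.Beta.FP.TowerK2bDefectClosed

open Finset Matrix
open Literature.MathematicalPhysics.QuantumFieldTheory
open Literature.MathematicalPhysics.QuantumFieldTheory.Balaban1983to89
open Literature.MathematicalPhysics.QuantumFieldTheory.Balaban1983to89.Beta
open B4TorusKernel.MultiPeriod (translate)
open B6Lemma24Torus (pbox)
open ExpKernelCalculus (MKer)
open AffineAveraging (Site)
open AveragingContoursRooted (ctr ctrOff)
open OneStepResolventKernel (Fib)
open BalabanStepW2 (M2Of wM2)
open Summit.QuantumFields.BalabanUV.Beta.TameKernelCalculus (trK)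
open Summit.QuantumFields.BalabanUV.Beta.BorderedHessian (sgnK)
open Summit.QuantumFields.BalabanUV.Beta.SymAveragingHessianCounts (symLinKerAt symHessKerAt)
open Summit.QuantumFields.BalabanUV.Beta.CompositeVertexKernelRec (offs compLinKer)
open Summit.QuantumFields.BalabanUV.Beta.CompositeOneShotJets (compMix compH)
open Summit.QuantumFields.BalabanUV.Beta.FP.KernelPeriodisationFib (Idx perF)
open Summit.QuantumFields.BalabanUV.Beta.FP.KernelPeriodisationFibLoc (dper)
open Summit.QuantumFields.BalabanUV.Beta.FP.TorusGaugeCovariance (tgrad)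
open Summit.QuantumFields.BalabanUV.Beta.FP.TorusGaugeCovariancePairing (wrapPt)
open Summit.QuantumFields.BalabanUV.Beta.FP.TowerK2bStoreyBridgeTwo (def_depthTwo def_succ)
open B5Prop11Plancherel (fine)
open Summit.QuantumFields.BalabanUV.Beta.AxialDressingRooted (one_le_of_neZero)
open Summit.QuantumFields.BalabanUV.Beta.CompositeOneShotJets (tabsComp)
open Summit.QuantumFields.BalabanUV.Beta.CompositeOneShotJetData (Roots)
open Summit.QuantumFields.BalabanUV.Beta.FP.TorusCompositeObjects (towerTorus towerTorus_succ towerTorus_apply)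

variable {Lc : ℕ} [NeZero Lc]

section AllDepths

variable {M : Fin (3 + 1) → ℕ} [∀ μ, NeZero (M μ)] (L₂ j : ℕ)

/-- [folklore] **`def_allDepths` — THE END WRAPPER's WARD DEFECT IN CLOSED FORM AT EVERY COMPOSITE DEPTH**: with the site-remainder family `R` DISPLAYED by its
recursion (`hR0` = `def_depthTwo`'s word at depth 2; `hRsucc` = `def_succ`'s top transport-variation words one composite up `+` the window-weighted remainders one
composite down, at the window roots `(κ, Lc•w+e)`), for every `m`, every box `M = Lc^(m+2)·M′`, an2's even composite mixed family of depth `m+2` at `(ρ′, w)` and every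
torus gauge function: `Σ_b (Dλ)_b • ℳ̂₂ᵉ⁽ᵐ⁺²⁾(b)|ff = (−wM2) • (E_λ·Ĉ⁽ᵐ⁺²⁾_{ρ′,w} − Ĉ⁽ᵐ⁺²⁾_{ρ′,w}·E_λ) + Σ_s λ s • R m ρ′ w s` — induction on `m` generalising the coarse period. -/
theorem def_allDepths
    (R : ℕ → Fin (3 + 1) → Site (3 + 1) → ↥(pbox M) → Matrix (↥(pbox M) × Fin (3 + 1)) (↥(pbox M) × Fin (3 + 1)) ℝ)
    (hR0 : ∀ (ρ' : Fin (3 + 1)) (w : Site (3 + 1)) (s : ↥(pbox M)), R 0 ρ' w s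
      = wM2 3 L₂ j • ∑ κ₁ : Fin (3 + 1), ∑ e₁ ∈ offs Lc, ∑ κ₂ : Fin (3 + 1), ∑ e₂ ∈ offs Lc,
            symHessKerAt (ctr 4 Lc) Lc ρ' w (κ₁, (Lc : ℤ) • w + e₁) (κ₂, (Lc : ℤ) • w + e₂) •
              (Matrix.vecMulVec
                  (fun x : ↥(pbox M) × Fin (3 + 1) => ((if x.1 = s then (1 : ℝ) else 0) - (if wrapPt M ((Lc : ℤ) • ((Lc : ℤ) • w + e₁) + ctr 4 Lc) = s then (1 : ℝ) else 0))
                    * ∑' n : Site (3 + 1), symLinKerAt (ctr 4 Lc) Lc κ₁ ((Lc : ℤ) • w + e₁) (x.2, translate M (x.1 : Site (3 + 1)) n))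
                  (fun z : ↥(pbox M) × Fin (3 + 1) => ∑' n : Site (3 + 1), symLinKerAt (ctr 4 Lc) Lc κ₂ ((Lc : ℤ) • w + e₂) (z.2, translate M (z.1 : Site (3 + 1)) n))
                - Matrix.vecMulVec
                  (fun x : ↥(pbox M) × Fin (3 + 1) => ∑' n : Site (3 + 1), symLinKerAt (ctr 4 Lc) Lc κ₁ ((Lc : ℤ) • w + e₁) (x.2, translate M (x.1 : Site (3 + 1)) n))
                  (fun z : ↥(pbox M) × Fin (3 + 1) => ((if z.1 = s then (1 : ℝ) else 0) - (if wrapPt M ((Lc : ℤ) • ((Lc : ℤ) • w + e₂) + ctr 4 Lc) = s then (1 : ℝ) else 0))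
                    * ∑' n : Site (3 + 1), symLinKerAt (ctr 4 Lc) Lc κ₂ ((Lc : ℤ) • w + e₂) (z.2, translate M (z.1 : Site (3 + 1)) n))))
    (hRsucc : ∀ (m : ℕ) (ρ' : Fin (3 + 1)) (w : Site (3 + 1)) (s : ↥(pbox M)), R (m + 1) ρ' w s
      = wM2 3 L₂ j • (∑ κ₁ : Fin (3 + 1), ∑ e₁ ∈ offs Lc, ∑ κ₂ : Fin (3 + 1), ∑ e₂ ∈ offs Lc,
            symHessKerAt (ctr 4 Lc) Lc ρ' w (κ₁, (Lc : ℤ) • w + e₁) (κ₂, (Lc : ℤ) • w + e₂) •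
              (Matrix.vecMulVec
                  (fun x : ↥(pbox M) × Fin (3 + 1) => ((if x.1 = s then (1 : ℝ) else 0)
                      - (if wrapPt M (((Lc ^ (m + 1 + 1) : ℕ) : ℤ) • ((Lc : ℤ) • w + e₁) + ∑ k ∈ Finset.range (m + 1 + 1), ((Lc ^ k : ℕ) : ℤ) • ctr 4 Lc) = s then (1 : ℝ) else 0))
                    * ∑' n : Site (3 + 1), compLinKer (fun _ => symLinKerAt (ctr 4 Lc) Lc) Lc (m + 1 + 1) (x.2, translate M (x.1 : Site (3 + 1)) n) (κ₁, (Lc : ℤ) • w + e₁))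
                  (fun z : ↥(pbox M) × Fin (3 + 1) => ∑' n : Site (3 + 1),
                    compLinKer (fun _ => symLinKerAt (ctr 4 Lc) Lc) Lc (m + 1 + 1) (z.2, translate M (z.1 : Site (3 + 1)) n) (κ₂, (Lc : ℤ) • w + e₂))
                - Matrix.vecMulVec
                  (fun x : ↥(pbox M) × Fin (3 + 1) => ∑' n : Site (3 + 1),
                    compLinKer (fun _ => symLinKerAt (ctr 4 Lc) Lc) Lc (m + 1 + 1) (x.2, translate M (x.1 : Site (3 + 1)) n) (κ₁, (Lc : ℤ) • w + e₁))
                  (fun z : ↥(pbox M) × Fin (3 + 1) => ((if z.1 = s then (1 : ℝ) else 0)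
                      - (if wrapPt M (((Lc ^ (m + 1 + 1) : ℕ) : ℤ) • ((Lc : ℤ) • w + e₂) + ∑ k ∈ Finset.range (m + 1 + 1), ((Lc ^ k : ℕ) : ℤ) • ctr 4 Lc) = s then (1 : ℝ) else 0))
                    * ∑' n : Site (3 + 1), compLinKer (fun _ => symLinKerAt (ctr 4 Lc) Lc) Lc (m + 1 + 1) (z.2, translate M (z.1 : Site (3 + 1)) n) (κ₂, (Lc : ℤ) • w + e₂))))
        + ∑ κ : Fin (3 + 1), ∑ e ∈ offs Lc, symLinKerAt (ctr 4 Lc) Lc ρ' w (κ, (Lc : ℤ) • w + e) • R m κ ((Lc : ℤ) • w + e) s)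
    (m : ℕ) (M' : Fin (3 + 1) → ℕ) [hM' : ∀ μ, NeZero (M' μ)] (hM : ∀ i, M i = Lc ^ (m + 1 + 1) * M' i)
    (ρ' : Fin (3 + 1)) (w : Site (3 + 1)) (V : Fin (3 + 1) → Site (3 + 1) → MKer (3 + 1) (Fib 3))
    (hV : V = fun κ u x z a c => ∑' n : Site (3 + 1),
      ((1 / 2 : ℝ) • (M2Of 3 L₂ (compMix (ctrOff (3 + 1) Lc) Lc (m + 1 + 1)) j κ u ρ' (translate M' w n)
          + sgnK (trK (M2Of 3 L₂ (compMix (ctrOff (3 + 1) Lc) Lc (m + 1 + 1)) j κ u ρ' (translate M' w n))))) x z a c)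
    (lam : ↥(pbox M) → ℝ) :
    (∑ b : ↥(pbox M) × Fin (3 + 1), (∑ s : ↥(pbox M), tgrad M (b.1, Sum.inl b.2) s * lam s) •
        (perF M (dper M (V b.2 (b.1 : Site (3 + 1))))).submatrix
          (fun b : ↥(pbox M) × Fin (3 + 1) => ((b.1, Sum.inl b.2) : Idx M (Fib 3)))
          (fun b : ↥(pbox M) × Fin (3 + 1) => ((b.1, Sum.inl b.2) : Idx M (Fib 3))))
      = (-(wM2 3 L₂ j)) • (Matrix.diagonal (fun b : ↥(pbox M) × Fin (3 + 1) => lam b.1)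
            * (perF M (dper M (compH (ctrOff (3 + 1) Lc) Lc (m + 1 + 1) ρ' w))).submatrix
                (fun b : ↥(pbox M) × Fin (3 + 1) => ((b.1, Sum.inl b.2) : Idx M (Fib 3)))
                (fun b : ↥(pbox M) × Fin (3 + 1) => ((b.1, Sum.inl b.2) : Idx M (Fib 3)))
          - (perF M (dper M (compH (ctrOff (3 + 1) Lc) Lc (m + 1 + 1) ρ' w))).submatrix
                (fun b : ↥(pbox M) × Fin (3 + 1) => ((b.1, Sum.inl b.2) : Idx M (Fib 3)))
                (fun b : ↥(pbox M) × Fin (3 + 1) => ((b.1, Sum.inl b.2) : Idx M (Fib 3)))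
            * Matrix.diagonal (fun b : ↥(pbox M) × Fin (3 + 1) => lam b.1))
        + ∑ s : ↥(pbox M), lam s • R m ρ' w s := by
  induction m generalizing M' hM' ρ' w V with
  | zero =>
    simp only [hR0]
    exact def_depthTwo L₂ j ρ' w hM hV lam
  | succ m ih =>
    simp only [hRsucc]
    exact def_succ L₂ j (m + 1 + 1) ρ' w hM hV (fun _ _ => rfl) lam (fun s κ e => R m κ ((Lc : ℤ) • w + e) s)
      (fun κ e => ih (fun i => Lc * M' i) (fun i => by rw [hM i]; ring) κ ((Lc : ℤ) • w + e) _ rfl)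

end AllDepths

/-! ## §2 Depth 3 unrolled — no letter (Engine C's K2L objects at `n = 1`: `def_succ` at `m = 2` over `def_depthTwo` at the sixteen window roots) -/

section DepthThree

variable {M M' : Fin (3 + 1) → ℕ} [∀ μ, NeZero (M μ)] [∀ μ, NeZero (M' μ)] (L₂ j : ℕ) (ρ' : Fin (3 + 1)) (w : Site (3 + 1))
  {V : Fin (3 + 1) → Site (3 + 1) → MKer (3 + 1) (Fib 3)}

/-- [folklore] **`def_depthThree` — THE WARD DEFECT AT DEPTH 3, FULLY UNROLLED** (any box `M = Lc³·M′`): the top storey's transport-variation words (legs `compLinKer 2`, roots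
`Lc²•(Lc•w+e) + (1 + Lc)•ρ_c` wrapped) `+ Σ_{κ,e} ℓ(ρ′,w; κ, Lc•w+e) •` the depth-2 word of `def_depthTwo` at the window root `(κ, Lc•w+e)` — `def_succ 2 ∘ def_depthTwo`, no remainder letter. -/
theorem def_depthThree (hM : ∀ i, M i = Lc ^ 3 * M' i)
    (hV : V = fun κ u x z a c => ∑' n : Site (3 + 1),
      ((1 / 2 : ℝ) • (M2Of 3 L₂ (compMix (ctrOff (3 + 1) Lc) Lc 3) j κ u ρ' (translate M' w n)
          + sgnK (trK (M2Of 3 L₂ (compMix (ctrOff (3 + 1) Lc) Lc 3) j κ u ρ' (translate M' w n))))) x z a c)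
    (lam : ↥(pbox M) → ℝ) :
    (∑ b : ↥(pbox M) × Fin (3 + 1), (∑ s : ↥(pbox M), tgrad M (b.1, Sum.inl b.2) s * lam s) •
        (perF M (dper M (V b.2 (b.1 : Site (3 + 1))))).submatrix
          (fun b : ↥(pbox M) × Fin (3 + 1) => ((b.1, Sum.inl b.2) : Idx M (Fib 3)))
          (fun b : ↥(pbox M) × Fin (3 + 1) => ((b.1, Sum.inl b.2) : Idx M (Fib 3))))
      = (-(wM2 3 L₂ j)) • (Matrix.diagonal (fun b : ↥(pbox M) × Fin (3 + 1) => lam b.1)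
            * (perF M (dper M (compH (ctrOff (3 + 1) Lc) Lc 3 ρ' w))).submatrix
                (fun b : ↥(pbox M) × Fin (3 + 1) => ((b.1, Sum.inl b.2) : Idx M (Fib 3)))
                (fun b : ↥(pbox M) × Fin (3 + 1) => ((b.1, Sum.inl b.2) : Idx M (Fib 3)))
          - (perF M (dper M (compH (ctrOff (3 + 1) Lc) Lc 3 ρ' w))).submatrix
                (fun b : ↥(pbox M) × Fin (3 + 1) => ((b.1, Sum.inl b.2) : Idx M (Fib 3)))
                (fun b : ↥(pbox M) × Fin (3 + 1) => ((b.1, Sum.inl b.2) : Idx M (Fib 3)))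
            * Matrix.diagonal (fun b : ↥(pbox M) × Fin (3 + 1) => lam b.1))
        + ∑ s : ↥(pbox M), lam s • (wM2 3 L₂ j • (∑ κ₁ : Fin (3 + 1), ∑ e₁ ∈ offs Lc, ∑ κ₂ : Fin (3 + 1), ∑ e₂ ∈ offs Lc,
            symHessKerAt (ctr 4 Lc) Lc ρ' w (κ₁, (Lc : ℤ) • w + e₁) (κ₂, (Lc : ℤ) • w + e₂) •
              (Matrix.vecMulVec
                  (fun x : ↥(pbox M) × Fin (3 + 1) => ((if x.1 = s then (1 : ℝ) else 0)
                      - (if wrapPt M (((Lc ^ 2 : ℕ) : ℤ) • ((Lc : ℤ) • w + e₁) + ∑ k ∈ Finset.range 2, ((Lc ^ k : ℕ) : ℤ) • ctr 4 Lc) = s then (1 : ℝ) else 0))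
                    * ∑' n : Site (3 + 1), compLinKer (fun _ => symLinKerAt (ctr 4 Lc) Lc) Lc 2 (x.2, translate M (x.1 : Site (3 + 1)) n) (κ₁, (Lc : ℤ) • w + e₁))
                  (fun z : ↥(pbox M) × Fin (3 + 1) => ∑' n : Site (3 + 1),
                    compLinKer (fun _ => symLinKerAt (ctr 4 Lc) Lc) Lc 2 (z.2, translate M (z.1 : Site (3 + 1)) n) (κ₂, (Lc : ℤ) • w + e₂))
                - Matrix.vecMulVec
                  (fun x : ↥(pbox M) × Fin (3 + 1) => ∑' n : Site (3 + 1),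
                    compLinKer (fun _ => symLinKerAt (ctr 4 Lc) Lc) Lc 2 (x.2, translate M (x.1 : Site (3 + 1)) n) (κ₁, (Lc : ℤ) • w + e₁))
                  (fun z : ↥(pbox M) × Fin (3 + 1) => ((if z.1 = s then (1 : ℝ) else 0)
                      - (if wrapPt M (((Lc ^ 2 : ℕ) : ℤ) • ((Lc : ℤ) • w + e₂) + ∑ k ∈ Finset.range 2, ((Lc ^ k : ℕ) : ℤ) • ctr 4 Lc) = s then (1 : ℝ) else 0))
                    * ∑' n : Site (3 + 1), compLinKer (fun _ => symLinKerAt (ctr 4 Lc) Lc) Lc 2 (z.2, translate M (z.1 : Site (3 + 1)) n) (κ₂, (Lc : ℤ) • w + e₂))))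
            + ∑ κ : Fin (3 + 1), ∑ e ∈ offs Lc, symLinKerAt (ctr 4 Lc) Lc ρ' w (κ, (Lc : ℤ) • w + e) •
              (wM2 3 L₂ j • ∑ κ₁ : Fin (3 + 1), ∑ e₁ ∈ offs Lc, ∑ κ₂ : Fin (3 + 1), ∑ e₂ ∈ offs Lc,
                symHessKerAt (ctr 4 Lc) Lc κ ((Lc : ℤ) • w + e) (κ₁, (Lc : ℤ) • ((Lc : ℤ) • w + e) + e₁) (κ₂, (Lc : ℤ) • ((Lc : ℤ) • w + e) + e₂) •
                  (Matrix.vecMulVec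
                      (fun x : ↥(pbox M) × Fin (3 + 1) => ((if x.1 = s then (1 : ℝ) else 0)
                          - (if wrapPt M ((Lc : ℤ) • ((Lc : ℤ) • ((Lc : ℤ) • w + e) + e₁) + ctr 4 Lc) = s then (1 : ℝ) else 0))
                        * ∑' n : Site (3 + 1), symLinKerAt (ctr 4 Lc) Lc κ₁ ((Lc : ℤ) • ((Lc : ℤ) • w + e) + e₁) (x.2, translate M (x.1 : Site (3 + 1)) n))
                      (fun z : ↥(pbox M) × Fin (3 + 1) => ∑' n : Site (3 + 1),
                        symLinKerAt (ctr 4 Lc) Lc κ₂ ((Lc : ℤ) • ((Lc : ℤ) • w + e) + e₂) (z.2, translate M (z.1 : Site (3 + 1)) n))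
                    - Matrix.vecMulVec
                      (fun x : ↥(pbox M) × Fin (3 + 1) => ∑' n : Site (3 + 1),
                        symLinKerAt (ctr 4 Lc) Lc κ₁ ((Lc : ℤ) • ((Lc : ℤ) • w + e) + e₁) (x.2, translate M (x.1 : Site (3 + 1)) n))
                      (fun z : ↥(pbox M) × Fin (3 + 1) => ((if z.1 = s then (1 : ℝ) else 0)
                          - (if wrapPt M ((Lc : ℤ) • ((Lc : ℤ) • ((Lc : ℤ) • w + e) + e₂) + ctr 4 Lc) = s then (1 : ℝ) else 0))
                        * ∑' n : Site (3 + 1), symLinKerAt (ctr 4 Lc) Lc κ₂ ((Lc : ℤ) • ((Lc : ℤ) • w + e) + e₂) (z.2, translate M (z.1 : Site (3 + 1)) n))))) :=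
  def_succ L₂ j 2 ρ' w hM hV (fun _ _ => rfl) lam _
    (fun κ e => def_depthTwo (M' := fun i => Lc * M' i) L₂ j κ ((Lc : ℤ) • w + e) (fun i => by rw [hM i]; ring) rfl lam)

end DepthThree

/-! ## §3 The wrapper's `Def` IS `Σ_s λ s • R m` (v8∕v9's (J-R₂″) word at box `n = m`, solved for the defect) -/

section Defect

variable {M : Fin (3 + 1) → ℕ} [∀ μ, NeZero (M μ)] (L₂ j : ℕ)

/-- [folklore] **`defect_eq_sum_smul_R`** — `def_allDepths` solved for the defect: at every depth `m+2`, `Σ_b (Dλ)_b • ℳ̂₂ᵉ(b)|ff − (−wM2) • (E_λ·Ĉ − Ĉ·E_λ) = Σ_s λ s • R m ρ′ w s`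
(the END wrapper's `Def(λ; ρ′,w)` at box `n = m`, `κ₂ = −wM2`, as the λ-superposition of the displayed site remainders — what (J-R₂″) contracts against `Ŝ`). -/
theorem defect_eq_sum_smul_R
    (R : ℕ → Fin (3 + 1) → Site (3 + 1) → ↥(pbox M) → Matrix (↥(pbox M) × Fin (3 + 1)) (↥(pbox M) × Fin (3 + 1)) ℝ)
    (hR0 : ∀ (ρ' : Fin (3 + 1)) (w : Site (3 + 1)) (s : ↥(pbox M)), R 0 ρ' w s
      = wM2 3 L₂ j • ∑ κ₁ : Fin (3 + 1), ∑ e₁ ∈ offs Lc, ∑ κ₂ : Fin (3 + 1), ∑ e₂ ∈ offs Lc,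
            symHessKerAt (ctr 4 Lc) Lc ρ' w (κ₁, (Lc : ℤ) • w + e₁) (κ₂, (Lc : ℤ) • w + e₂) •
              (Matrix.vecMulVec
                  (fun x : ↥(pbox M) × Fin (3 + 1) => ((if x.1 = s then (1 : ℝ) else 0) - (if wrapPt M ((Lc : ℤ) • ((Lc : ℤ) • w + e₁) + ctr 4 Lc) = s then (1 : ℝ) else 0))
                    * ∑' n : Site (3 + 1), symLinKerAt (ctr 4 Lc) Lc κ₁ ((Lc : ℤ) • w + e₁) (x.2, translate M (x.1 : Site (3 + 1)) n))
                  (fun z : ↥(pbox M) × Fin (3 + 1) => ∑' n : Site (3 + 1), symLinKerAt (ctr 4 Lc) Lc κ₂ ((Lc : ℤ) • w + e₂) (z.2, translate M (z.1 : Site (3 + 1)) n))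
                - Matrix.vecMulVec
                  (fun x : ↥(pbox M) × Fin (3 + 1) => ∑' n : Site (3 + 1), symLinKerAt (ctr 4 Lc) Lc κ₁ ((Lc : ℤ) • w + e₁) (x.2, translate M (x.1 : Site (3 + 1)) n))
                  (fun z : ↥(pbox M) × Fin (3 + 1) => ((if z.1 = s then (1 : ℝ) else 0) - (if wrapPt M ((Lc : ℤ) • ((Lc : ℤ) • w + e₂) + ctr 4 Lc) = s then (1 : ℝ) else 0))
                    * ∑' n : Site (3 + 1), symLinKerAt (ctr 4 Lc) Lc κ₂ ((Lc : ℤ) • w + e₂) (z.2, translate M (z.1 : Site (3 + 1)) n))))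
    (hRsucc : ∀ (m : ℕ) (ρ' : Fin (3 + 1)) (w : Site (3 + 1)) (s : ↥(pbox M)), R (m + 1) ρ' w s
      = wM2 3 L₂ j • (∑ κ₁ : Fin (3 + 1), ∑ e₁ ∈ offs Lc, ∑ κ₂ : Fin (3 + 1), ∑ e₂ ∈ offs Lc,
            symHessKerAt (ctr 4 Lc) Lc ρ' w (κ₁, (Lc : ℤ) • w + e₁) (κ₂, (Lc : ℤ) • w + e₂) •
              (Matrix.vecMulVec
                  (fun x : ↥(pbox M) × Fin (3 + 1) => ((if x.1 = s then (1 : ℝ) else 0)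
                      - (if wrapPt M (((Lc ^ (m + 1 + 1) : ℕ) : ℤ) • ((Lc : ℤ) • w + e₁) + ∑ k ∈ Finset.range (m + 1 + 1), ((Lc ^ k : ℕ) : ℤ) • ctr 4 Lc) = s then (1 : ℝ) else 0))
                    * ∑' n : Site (3 + 1), compLinKer (fun _ => symLinKerAt (ctr 4 Lc) Lc) Lc (m + 1 + 1) (x.2, translate M (x.1 : Site (3 + 1)) n) (κ₁, (Lc : ℤ) • w + e₁))
                  (fun z : ↥(pbox M) × Fin (3 + 1) => ∑' n : Site (3 + 1),
                    compLinKer (fun _ => symLinKerAt (ctr 4 Lc) Lc) Lc (m + 1 + 1) (z.2, translate M (z.1 : Site (3 + 1)) n) (κ₂, (Lc : ℤ) • w + e₂))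
                - Matrix.vecMulVec
                  (fun x : ↥(pbox M) × Fin (3 + 1) => ∑' n : Site (3 + 1),
                    compLinKer (fun _ => symLinKerAt (ctr 4 Lc) Lc) Lc (m + 1 + 1) (x.2, translate M (x.1 : Site (3 + 1)) n) (κ₁, (Lc : ℤ) • w + e₁))
                  (fun z : ↥(pbox M) × Fin (3 + 1) => ((if z.1 = s then (1 : ℝ) else 0)
                      - (if wrapPt M (((Lc ^ (m + 1 + 1) : ℕ) : ℤ) • ((Lc : ℤ) • w + e₂) + ∑ k ∈ Finset.range (m + 1 + 1), ((Lc ^ k : ℕ) : ℤ) • ctr 4 Lc) = s then (1 : ℝ) else 0))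
                    * ∑' n : Site (3 + 1), compLinKer (fun _ => symLinKerAt (ctr 4 Lc) Lc) Lc (m + 1 + 1) (z.2, translate M (z.1 : Site (3 + 1)) n) (κ₂, (Lc : ℤ) • w + e₂))))
        + ∑ κ : Fin (3 + 1), ∑ e ∈ offs Lc, symLinKerAt (ctr 4 Lc) Lc ρ' w (κ, (Lc : ℤ) • w + e) • R m κ ((Lc : ℤ) • w + e) s)
    (m : ℕ) (M' : Fin (3 + 1) → ℕ) [∀ μ, NeZero (M' μ)] (hM : ∀ i, M i = Lc ^ (m + 1 + 1) * M' i)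
    (ρ' : Fin (3 + 1)) (w : Site (3 + 1)) (V : Fin (3 + 1) → Site (3 + 1) → MKer (3 + 1) (Fib 3))
    (hV : V = fun κ u x z a c => ∑' n : Site (3 + 1),
      ((1 / 2 : ℝ) • (M2Of 3 L₂ (compMix (ctrOff (3 + 1) Lc) Lc (m + 1 + 1)) j κ u ρ' (translate M' w n)
          + sgnK (trK (M2Of 3 L₂ (compMix (ctrOff (3 + 1) Lc) Lc (m + 1 + 1)) j κ u ρ' (translate M' w n))))) x z a c)
    (lam : ↥(pbox M) → ℝ) :
    (∑ b : ↥(pbox M) × Fin (3 + 1), (∑ s : ↥(pbox M), tgrad M (b.1, Sum.inl b.2) s * lam s) •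
        (perF M (dper M (V b.2 (b.1 : Site (3 + 1))))).submatrix
          (fun b : ↥(pbox M) × Fin (3 + 1) => ((b.1, Sum.inl b.2) : Idx M (Fib 3)))
          (fun b : ↥(pbox M) × Fin (3 + 1) => ((b.1, Sum.inl b.2) : Idx M (Fib 3))))
        - (-(wM2 3 L₂ j)) • (Matrix.diagonal (fun b : ↥(pbox M) × Fin (3 + 1) => lam b.1)
            * (perF M (dper M (compH (ctrOff (3 + 1) Lc) Lc (m + 1 + 1) ρ' w))).submatrix
                (fun b : ↥(pbox M) × Fin (3 + 1) => ((b.1, Sum.inl b.2) : Idx M (Fib 3)))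
                (fun b : ↥(pbox M) × Fin (3 + 1) => ((b.1, Sum.inl b.2) : Idx M (Fib 3)))
          - (perF M (dper M (compH (ctrOff (3 + 1) Lc) Lc (m + 1 + 1) ρ' w))).submatrix
                (fun b : ↥(pbox M) × Fin (3 + 1) => ((b.1, Sum.inl b.2) : Idx M (Fib 3)))
                (fun b : ↥(pbox M) × Fin (3 + 1) => ((b.1, Sum.inl b.2) : Idx M (Fib 3)))
            * Matrix.diagonal (fun b : ↥(pbox M) × Fin (3 + 1) => lam b.1))
      = ∑ s : ↥(pbox M), lam s • R m ρ' w s :=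
  sub_eq_of_eq_add' (def_allDepths L₂ j R hR0 hRsucc m M' hM ρ' w V hV lam)

end Defect

/-! ## §4 At the END wrapper's letters (v8∕v9 `hM₂` ∕ `hR₂`): finest torus `towerTorus Lc (fine Lc Mc) (n+1)`, coarse period `Mc`, weights `M2Of 3 (Lc^(n+2)) … 0`, tables `tabsComp (n+2) … (Roots.ctr Lc).hr cM` -/

section Wrapper

variable (Mc : Fin (3 + 1) → ℕ) [∀ μ, NeZero (Mc μ)] (n : ℕ) (cM : ℕ → ℝ)

/-- [folklore] **`defect_eq_sum_smul_R_wrapper` — §3 AT THE END WRAPPER's OWN LETTERS** (junction by kernel, not by docstring): on the wrapper's finest torus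
`T = towerTorus Lc (fine Lc Mc) (n+1)` (`T i = Lc^(n+2)·Mc i`, `towerTorus_succ ∕ towerTorus_apply`), with v8∕v9's pinned even mixed family (`hM₂`: weights `M2Of 3 (Lc^(n+2)) … 0`, table
`(tabsComp (n+2) … (Roots.ctr Lc).hr cM).mixFF` = `compMix (ctrOff 4 Lc) Lc (n+2)` by `rfl`) and composite constraint Hessian `(tabsComp (n+2) …).H` (= `compH …` by `rfl`) at the coarse bond `β`:
v8∕v9's `Def(λ; β)` at `κ₂ := −wM2 3 (Lc^(n+2)) 0` IS `Σ_s λ s • R n β.2 ↑β.1 s` — `defect_eq_sum_smul_R` at `(M, M′, L₂, j, ρ′, w) := (T, Mc, Lc^(n+2), 0, β.2, ↑β.1)`, `rfl` on the family. -/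
theorem defect_eq_sum_smul_R_wrapper
    (R : ℕ → Fin (3 + 1) → Site (3 + 1) → ↥(pbox (towerTorus Lc (fine Lc Mc) (n + 1)))
      → Matrix (↥(pbox (towerTorus Lc (fine Lc Mc) (n + 1))) × Fin (3 + 1)) (↥(pbox (towerTorus Lc (fine Lc Mc) (n + 1))) × Fin (3 + 1)) ℝ)
    (hR0 : ∀ (ρ' : Fin (3 + 1)) (w : Site (3 + 1)) (s : ↥(pbox (towerTorus Lc (fine Lc Mc) (n + 1)))), R 0 ρ' w s
      = wM2 3 (Lc ^ (n + 1 + 1)) 0 • ∑ κ₁ : Fin (3 + 1), ∑ e₁ ∈ offs Lc, ∑ κ₂ : Fin (3 + 1), ∑ e₂ ∈ offs Lc,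
            symHessKerAt (ctr 4 Lc) Lc ρ' w (κ₁, (Lc : ℤ) • w + e₁) (κ₂, (Lc : ℤ) • w + e₂) •
              (Matrix.vecMulVec
                  (fun x : ↥(pbox (towerTorus Lc (fine Lc Mc) (n + 1))) × Fin (3 + 1) => ((if x.1 = s then (1 : ℝ) else 0)
                      - (if wrapPt (towerTorus Lc (fine Lc Mc) (n + 1)) ((Lc : ℤ) • ((Lc : ℤ) • w + e₁) + ctr 4 Lc) = s then (1 : ℝ) else 0))
                    * ∑' t : Site (3 + 1), symLinKerAt (ctr 4 Lc) Lc κ₁ ((Lc : ℤ) • w + e₁) (x.2, translate (towerTorus Lc (fine Lc Mc) (n + 1)) (x.1 : Site (3 + 1)) t))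
                  (fun z : ↥(pbox (towerTorus Lc (fine Lc Mc) (n + 1))) × Fin (3 + 1) => ∑' t : Site (3 + 1),
                    symLinKerAt (ctr 4 Lc) Lc κ₂ ((Lc : ℤ) • w + e₂) (z.2, translate (towerTorus Lc (fine Lc Mc) (n + 1)) (z.1 : Site (3 + 1)) t))
                - Matrix.vecMulVec
                  (fun x : ↥(pbox (towerTorus Lc (fine Lc Mc) (n + 1))) × Fin (3 + 1) => ∑' t : Site (3 + 1),
                    symLinKerAt (ctr 4 Lc) Lc κ₁ ((Lc : ℤ) • w + e₁) (x.2, translate (towerTorus Lc (fine Lc Mc) (n + 1)) (x.1 : Site (3 + 1)) t))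
                  (fun z : ↥(pbox (towerTorus Lc (fine Lc Mc) (n + 1))) × Fin (3 + 1) => ((if z.1 = s then (1 : ℝ) else 0)
                      - (if wrapPt (towerTorus Lc (fine Lc Mc) (n + 1)) ((Lc : ℤ) • ((Lc : ℤ) • w + e₂) + ctr 4 Lc) = s then (1 : ℝ) else 0))
                    * ∑' t : Site (3 + 1), symLinKerAt (ctr 4 Lc) Lc κ₂ ((Lc : ℤ) • w + e₂) (z.2, translate (towerTorus Lc (fine Lc Mc) (n + 1)) (z.1 : Site (3 + 1)) t))))
    (hRsucc : ∀ (m : ℕ) (ρ' : Fin (3 + 1)) (w : Site (3 + 1)) (s : ↥(pbox (towerTorus Lc (fine Lc Mc) (n + 1)))), R (m + 1) ρ' w s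
      = wM2 3 (Lc ^ (n + 1 + 1)) 0 • (∑ κ₁ : Fin (3 + 1), ∑ e₁ ∈ offs Lc, ∑ κ₂ : Fin (3 + 1), ∑ e₂ ∈ offs Lc,
            symHessKerAt (ctr 4 Lc) Lc ρ' w (κ₁, (Lc : ℤ) • w + e₁) (κ₂, (Lc : ℤ) • w + e₂) •
              (Matrix.vecMulVec
                  (fun x : ↥(pbox (towerTorus Lc (fine Lc Mc) (n + 1))) × Fin (3 + 1) => ((if x.1 = s then (1 : ℝ) else 0)
                      - (if wrapPt (towerTorus Lc (fine Lc Mc) (n + 1)) (((Lc ^ (m + 1 + 1) : ℕ) : ℤ) • ((Lc : ℤ) • w + e₁) + ∑ k ∈ Finset.range (m + 1 + 1), ((Lc ^ k : ℕ) : ℤ) • ctr 4 Lc) = s then (1 : ℝ) else 0))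
                    * ∑' t : Site (3 + 1), compLinKer (fun _ => symLinKerAt (ctr 4 Lc) Lc) Lc (m + 1 + 1) (x.2, translate (towerTorus Lc (fine Lc Mc) (n + 1)) (x.1 : Site (3 + 1)) t) (κ₁, (Lc : ℤ) • w + e₁))
                  (fun z : ↥(pbox (towerTorus Lc (fine Lc Mc) (n + 1))) × Fin (3 + 1) => ∑' t : Site (3 + 1),
                    compLinKer (fun _ => symLinKerAt (ctr 4 Lc) Lc) Lc (m + 1 + 1) (z.2, translate (towerTorus Lc (fine Lc Mc) (n + 1)) (z.1 : Site (3 + 1)) t) (κ₂, (Lc : ℤ) • w + e₂))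
                - Matrix.vecMulVec
                  (fun x : ↥(pbox (towerTorus Lc (fine Lc Mc) (n + 1))) × Fin (3 + 1) => ∑' t : Site (3 + 1),
                    compLinKer (fun _ => symLinKerAt (ctr 4 Lc) Lc) Lc (m + 1 + 1) (x.2, translate (towerTorus Lc (fine Lc Mc) (n + 1)) (x.1 : Site (3 + 1)) t) (κ₁, (Lc : ℤ) • w + e₁))
                  (fun z : ↥(pbox (towerTorus Lc (fine Lc Mc) (n + 1))) × Fin (3 + 1) => ((if z.1 = s then (1 : ℝ) else 0)
                      - (if wrapPt (towerTorus Lc (fine Lc Mc) (n + 1)) (((Lc ^ (m + 1 + 1) : ℕ) : ℤ) • ((Lc : ℤ) • w + e₂) + ∑ k ∈ Finset.range (m + 1 + 1), ((Lc ^ k : ℕ) : ℤ) • ctr 4 Lc) = s then (1 : ℝ) else 0))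
                    * ∑' t : Site (3 + 1), compLinKer (fun _ => symLinKerAt (ctr 4 Lc) Lc) Lc (m + 1 + 1) (z.2, translate (towerTorus Lc (fine Lc Mc) (n + 1)) (z.1 : Site (3 + 1)) t) (κ₂, (Lc : ℤ) • w + e₂))))
        + ∑ κ : Fin (3 + 1), ∑ e ∈ offs Lc, symLinKerAt (ctr 4 Lc) Lc ρ' w (κ, (Lc : ℤ) • w + e) • R m κ ((Lc : ℤ) • w + e) s)
    (β : ↥(pbox Mc) × Fin (3 + 1)) (lam : ↥(pbox (towerTorus Lc (fine Lc Mc) (n + 1))) → ℝ) :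
    (∑ b : ↥(pbox (towerTorus Lc (fine Lc Mc) (n + 1))) × Fin (3 + 1),
        (∑ s : ↥(pbox (towerTorus Lc (fine Lc Mc) (n + 1))), tgrad (towerTorus Lc (fine Lc Mc) (n + 1)) (b.1, Sum.inl b.2) s * lam s) •
        (perF (towerTorus Lc (fine Lc Mc) (n + 1)) (dper (towerTorus Lc (fine Lc Mc) (n + 1)) (fun X Z i₁ i₂ => ∑' m : Site (3 + 1),
          ((1 / 2 : ℝ) • (M2Of 3 (Lc ^ (n + 1 + 1)) (tabsComp (n + 1 + 1) (one_le_of_neZero Lc) (Roots.ctr Lc).hr cM).mixFF 0 b.2 (b.1 : Site (3 + 1)) β.2 (translate Mc (β.1 : Site (3 + 1)) m)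
            + sgnK (trK (M2Of 3 (Lc ^ (n + 1 + 1)) (tabsComp (n + 1 + 1) (one_le_of_neZero Lc) (Roots.ctr Lc).hr cM).mixFF 0 b.2 (b.1 : Site (3 + 1)) β.2 (translate Mc (β.1 : Site (3 + 1)) m))))) X Z i₁ i₂))).submatrix
          (fun b : ↥(pbox (towerTorus Lc (fine Lc Mc) (n + 1))) × Fin (3 + 1) => ((b.1, Sum.inl b.2) : Idx (towerTorus Lc (fine Lc Mc) (n + 1)) (Fib 3)))
          (fun b : ↥(pbox (towerTorus Lc (fine Lc Mc) (n + 1))) × Fin (3 + 1) => ((b.1, Sum.inl b.2) : Idx (towerTorus Lc (fine Lc Mc) (n + 1)) (Fib 3))))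
        - (-(wM2 3 (Lc ^ (n + 1 + 1)) 0)) • (Matrix.diagonal (fun b : ↥(pbox (towerTorus Lc (fine Lc Mc) (n + 1))) × Fin (3 + 1) => lam b.1)
            * (perF (towerTorus Lc (fine Lc Mc) (n + 1)) (dper (towerTorus Lc (fine Lc Mc) (n + 1))
                ((tabsComp (n + 1 + 1) (one_le_of_neZero Lc) (Roots.ctr Lc).hr cM).H β.2 (β.1 : Site (3 + 1))))).submatrix
                (fun b : ↥(pbox (towerTorus Lc (fine Lc Mc) (n + 1))) × Fin (3 + 1) => ((b.1, Sum.inl b.2) : Idx (towerTorus Lc (fine Lc Mc) (n + 1)) (Fib 3)))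
                (fun b : ↥(pbox (towerTorus Lc (fine Lc Mc) (n + 1))) × Fin (3 + 1) => ((b.1, Sum.inl b.2) : Idx (towerTorus Lc (fine Lc Mc) (n + 1)) (Fib 3)))
          - (perF (towerTorus Lc (fine Lc Mc) (n + 1)) (dper (towerTorus Lc (fine Lc Mc) (n + 1))
                ((tabsComp (n + 1 + 1) (one_le_of_neZero Lc) (Roots.ctr Lc).hr cM).H β.2 (β.1 : Site (3 + 1))))).submatrix
                (fun b : ↥(pbox (towerTorus Lc (fine Lc Mc) (n + 1))) × Fin (3 + 1) => ((b.1, Sum.inl b.2) : Idx (towerTorus Lc (fine Lc Mc) (n + 1)) (Fib 3)))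
                (fun b : ↥(pbox (towerTorus Lc (fine Lc Mc) (n + 1))) × Fin (3 + 1) => ((b.1, Sum.inl b.2) : Idx (towerTorus Lc (fine Lc Mc) (n + 1)) (Fib 3)))
            * Matrix.diagonal (fun b : ↥(pbox (towerTorus Lc (fine Lc Mc) (n + 1))) × Fin (3 + 1) => lam b.1))
      = ∑ s : ↥(pbox (towerTorus Lc (fine Lc Mc) (n + 1))), lam s • R n β.2 (β.1 : Site (3 + 1)) s := by
  have hM : ∀ i, towerTorus Lc (fine Lc Mc) (n + 1) i = Lc ^ (n + 1 + 1) * Mc i := fun i => by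
    rw [← towerTorus_succ, towerTorus_apply]
  exact defect_eq_sum_smul_R (Lc ^ (n + 1 + 1)) 0 R hR0 hRsucc n Mc hM β.2 (β.1 : Site (3 + 1)) _ rfl lam

end Wrapper

end Summit.QuantumFields.BalabanUV.Beta.FP.TowerK2bDefectClosed

end
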